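import Literature.NumberTheory.Automorphic.UnitaryGroupAutomorphicRep      -- ★ `UnitaryGroup.PlacesOver E v = {w : HeightOneSpectrum (𝓞 E) // w.under (𝓞 F) = v}`
import Mathlib.NumberTheory.NumberField.CMField                             -- `NumberField.maximalRealSubfield`, `IsCMField`
import Mathlib.RingTheory.Unramified.Locus                                  -- `Algebra.IsUnramifiedIn`
import HarnessLib

/-!
# R90-TF · S10 (Ch. 13.5–13.8 comparison) — the CONVERSE spelling bridge ★ unit-FL guard → ⟪U⟫:
# «`w` is unramified in `𝓞 L`» ⇒ «every place `W ∣ w` of `L` is unramified over `L⁺`»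

Cell `hodgecm-mathlib`, crux H413 (`stmt-HodgeConjecture-24833`, lane `--supports`, helper), route of record `HCCMUnconditional` (count-neutral).
Programme R90-TF, section S10 = Ch. 13.5–13.8 (base `R90-C138`), dealer R90-C138-plan (g0) DEAL 22:41:44Z «LAST BRICK» → seat R90-C131-p03 (g0) (S10 PEN);
junction J-A2c-2; companion of ★ `R90S10IsUnramifiedInOfPlacesOver` (p862583, the forward direction).  ONE THEOREM, hypothesis-free, no `def`, no `sorry`.

MATHEMATICS.  Mathlib's `Algebra.IsUnramifiedIn (𝓞 L) w.asIdeal` says every prime `𝔓` of `𝓞 L` lying over `w` is `Algebra.IsUnramifiedAt (𝓞 L⁺) 𝔓`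
(`RingTheory/Unramified/Locus.lean`).  A finite place `W` of `L` with `W.under (𝓞 L⁺) = w` (★ `UnitaryGroup.PlacesOver`) has `W.asIdeal` prime and lying over
`w.asIdeal` (Mathlib `HeightOneSpectrum.under` is `⟨W.asIdeal.under _, …⟩`, `Ideal.LiesOver` is `⟨p = P.under _⟩`), so the field-level guard of the tree's unit
fundamental lemma yields S10 FILE A's place-by-place token ⟪U⟫ — the direction an auxiliary globalisation outputs [Rogawski1990, §4.9 Prop. 4.9.1 (b) p. 55:
«E∕F is unramified»].  [cite: Rogawski1990, §4.9 Prop. 4.9.1 (b) p. 55] [cite: Neukirch1999, Ch. I §8 p. 49]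
HONEST LABEL: a spelling bridge; pays no socket by itself; HC_CM is proved only modulo the 7 printed citations (2 remaining named inputs: hLiu418 =
stmt-HodgeConjecture-24832, h413 = stmt-HodgeConjecture-24833) until rung 0 closes; REL ≠ ★ ≠ BUILT.
-/

set_option autoImplicit false
set_option linter.dupNamespace false

open NumberField IsDedekindDomain
open Literature.NumberTheory.Automorphic

namespace Summit.HodgeConjecture.HodgeConjecture.R90.S10

/-- **The ★ unit-FL field guard ⇒ ⟪U⟫.**  If the finite place `w` of `L⁺` is unramified in `𝓞 L` (`Algebra.IsUnramifiedIn (𝓞 L) w.asIdeal`, the hypothesis `hv` of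
★ `isLocalUnitTransfer_of_nonsplit_of_isUnit_two`), then every finite place `W` of the CM field `L` above `w` is unramified over `𝓞 L⁺`
(`Algebra.IsUnramifiedAt (𝓞 L⁺) W.1.asIdeal`, S10 FILE A's ⟪U⟫).  Converse of ★ `isUnramifiedIn_of_forall_placesOver`.
[cite: Rogawski1990, §4.9 Prop. 4.9.1 (b) p. 55] [cite: Neukirch1999, Ch. I §8 p. 49] -/
theorem forall_placesOver_isUnramifiedAt_of_isUnramifiedIn (L : Type) [Field L] [NumberField L] [IsCMField L]
    (w : HeightOneSpectrum (𝓞 ↥(maximalRealSubfield L)))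
    (h : Algebra.IsUnramifiedIn (R := 𝓞 ↥(maximalRealSubfield L)) (𝓞 L) w.asIdeal) :
    ∀ W : UnitaryGroup.PlacesOver L w, Algebra.IsUnramifiedAt (𝓞 ↥(maximalRealSubfield L)) W.1.asIdeal := by
  rintro ⟨W, rfl⟩
  exact h W.asIdeal W.isPrime ⟨rfl⟩

end Summit.HodgeConjecture.HodgeConjecture.R90.S10
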